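import Summits.CriticalPhenomena.PercolationContinuityZ3.Theorems.PercNearOneGluingNoHeavyLowerTailStarSetOmegaCliques
import HarnessLib

/-!
# `NoHeavyLowerTail` (stmt-CriticalPhenomena-4575) — the Ω-chords of a configuration without open r-free triangles form a star (L4.1)

Support file (prover `prim-gen-swap` gen 13; `--supports stmt-CriticalPhenomena-4575`).  No definitions, no named facts, no sorries.

Classes `X : ι` have port pairs `s(P X, P' X)` (`P X ≠ P' X`, pairwise distinct port pairs); two classes are ADJACENT when they share a
port.  Lemma L4.1 of the seat memo U1-PROOF.md (blueprint B2/B4): let `ω` be a configuration (finite set of classes) and `Ω ⊆ ω` a set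
of at least two classes avoiding the port `r`, each adjacent to EVERY class of `ω` (the Ω-chords).  If `ω` contains no r-free triangle
(three classes whose port pairs are the three sides `ab, ac, bc` of three distinct ports `a, b, c ≠ r` — excluded by rule A0 of the
memo), then there is a port `v ≠ r` contained in every class of `Ω` and in every class of `ω` (`STAR(v)`: `ω ⊆ K_v`).

* `StarSet.exists_three_of_triangle_of_not_star` — a family inside a triangle through no common port realises all three sides;
* `StarSet.omega_star_of_no_triangle` — L4.1;
* `StarSet.portPair_of_adjacent_triangle`, `StarSet.card_adjacent_triangle_le_three` — a class adjacent to the three sides of a triangle is a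
  side, so a configuration containing a triangle has at most three Ω-chords (rule A0).
-/

namespace Summit.CriticalPhenomena.PercolationContinuityZ3.Theorems

open Finset
open scoped BigOperators

namespace StarSet

variable {ι V : Type*}

/-- A family of classes with port pairs among the sides `ab, ac, bc` of a triangle and with NO common port contains classes realising
each of the three sides. -/
theorem exists_three_of_triangle_of_not_star (P P' : ι → V) (S : Finset ι) {a b c : V}
    (htri : ∀ X ∈ S, (s(P X, P' X) : Sym2 V) = s(a, b) ∨ (s(P X, P' X) : Sym2 V) = s(a, c) ∨
      (s(P X, P' X) : Sym2 V) = s(b, c))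
    (hnostar : ¬ ∃ v : V, ∀ X ∈ S, P X = v ∨ P' X = v) :
    (∃ X ∈ S, (s(P X, P' X) : Sym2 V) = s(a, b)) ∧ (∃ Y ∈ S, (s(P Y, P' Y) : Sym2 V) = s(a, c)) ∧
      ∃ Z ∈ S, (s(P Z, P' Z) : Sym2 V) = s(b, c) := by
  -- membership of a port in a class from its port pair
  have hmem : ∀ X : ι, ∀ u v : V, (s(P X, P' X) : Sym2 V) = s(u, v) → (P X = u ∨ P' X = u) ∧ (P X = v ∨ P' X = v) := by
    intro X u v h
    have hu : u ∈ (s(P X, P' X) : Sym2 V) := by rw [h]; exact Sym2.mem_mk_left u v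
    have hv : v ∈ (s(P X, P' X) : Sym2 V) := by rw [h]; exact Sym2.mem_mk_right u v
    rw [Sym2.mem_iff] at hu hv
    exact ⟨hu.imp Eq.symm Eq.symm, hv.imp Eq.symm Eq.symm⟩
  refine ⟨?_, ?_, ?_⟩
  · by_contra hno
    push Not at hno
    -- every class is `ac` or `bc`, hence contains `c`
    exact hnostar ⟨c, fun X hX => by
      rcases htri X hX with h | h | h
      · exact absurd h (hno X hX)
      · exact (hmem X a c h).2
      · exact (hmem X b c h).2⟩
  · by_contra hno
    push Not at hno
    exact hnostar ⟨b, fun X hX => by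
      rcases htri X hX with h | h | h
      · exact (hmem X a b h).2
      · exact absurd h (hno X hX)
      · exact (hmem X b c h).1⟩
  · by_contra hno
    push Not at hno
    exact hnostar ⟨a, fun X hX => by
      rcases htri X hX with h | h | h
      · exact (hmem X a b h).1
      · exact (hmem X a c h).1
      · exact absurd h (hno X hX)⟩

/-- **L4.1 of U1-PROOF.md (STAR(v)).**  If `Ω ⊆ ω` has at least two classes, all avoiding the port `r`, each adjacent to every class of
`ω`, and `ω` contains no r-free triangle, then some port `v ≠ r` lies in every class of `Ω` and in every class of `ω`. -/
theorem omega_star_of_no_triangle [DecidableEq V] (P P' : ι → V) (hPP' : ∀ X, P X ≠ P' X)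
    (hinj : Function.Injective fun X => (s(P X, P' X) : Sym2 V)) (r : V) (ω Ω : Finset ι) (hΩω : Ω ⊆ ω)
    (hcard : 2 ≤ Ω.card) (hΩr : ∀ X ∈ Ω, P X ≠ r ∧ P' X ≠ r)
    (hadj : ∀ X ∈ Ω, ∀ Y ∈ ω, P X = P Y ∨ P X = P' Y ∨ P' X = P Y ∨ P' X = P' Y)
    (hnotri : ¬ ∃ a b c : V, a ≠ b ∧ a ≠ c ∧ b ≠ c ∧ a ≠ r ∧ b ≠ r ∧ c ≠ r ∧
      (∃ X ∈ ω, (s(P X, P' X) : Sym2 V) = s(a, b)) ∧ (∃ Y ∈ ω, (s(P Y, P' Y) : Sym2 V) = s(a, c)) ∧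
        ∃ Z ∈ ω, (s(P Z, P' Z) : Sym2 V) = s(b, c)) :
    ∃ v : V, v ≠ r ∧ (∀ X ∈ Ω, P X = v ∨ P' X = v) ∧ ∀ Y ∈ ω, P Y = v ∨ P' Y = v := by
  classical
  have hΩne : Ω.Nonempty := card_pos.1 (by omega)
  have hΩadj : ∀ X ∈ Ω, ∀ Y ∈ Ω, P X = P Y ∨ P X = P' Y ∨ P' X = P Y ∨ P' X = P' Y :=
    fun X hX Y hY => hadj X hX Y (hΩω hY)
  -- membership of a port in a class from its port pair
  have hmem : ∀ X : ι, ∀ u w : V, (s(P X, P' X) : Sym2 V) = s(u, w) → (P X = u ∨ P' X = u) ∧ (P X = w ∨ P' X = w) := by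
    intro X u w h
    have hu : u ∈ (s(P X, P' X) : Sym2 V) := by rw [h]; exact Sym2.mem_mk_left u w
    have hw : w ∈ (s(P X, P' X) : Sym2 V) := by rw [h]; exact Sym2.mem_mk_right u w
    rw [Sym2.mem_iff] at hu hw
    exact ⟨hu.imp Eq.symm Eq.symm, hw.imp Eq.symm Eq.symm⟩
  -- a port of a class of `Ω` is not `r`
  have hport_ne_r : ∀ X ∈ Ω, ∀ u : V, (P X = u ∨ P' X = u) → u ≠ r := by
    rintro X hX u (h | h) <;> [exact h ▸ (hΩr X hX).1; exact h ▸ (hΩr X hX).2]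
  by_cases hstar : ∃ v : V, ∀ X ∈ Ω, P X = v ∨ P' X = v
  · -- STAR(v): `v ≠ r`, and every class of `ω` contains `v`
    obtain ⟨v, hv⟩ := hstar
    obtain ⟨X₁, hX₁⟩ := hΩne
    have hvr : v ≠ r := hport_ne_r X₁ hX₁ v (hv X₁ hX₁)
    refine ⟨v, hvr, hv, fun Y hY => ?_⟩
    -- a second class `X₂ ≠ X₁` of `Ω`
    obtain ⟨X₂, hX₂, hne⟩ : ∃ X₂ ∈ Ω, X₂ ≠ X₁ := by
      have : 1 < Ω.card := by omega
      obtain ⟨x, hx, y, hy, hxy⟩ := one_lt_card.1 this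
      by_cases h : x = X₁
      · exact ⟨y, hy, fun h' => hxy (h.trans h'.symm)⟩
      · exact ⟨x, hx, h⟩
    -- the far ports `a₁` of `X₁` and `a₂` of `X₂`
    obtain ⟨a₁, ha₁X, ha₁v⟩ : ∃ a₁, (P X₁ = a₁ ∨ P' X₁ = a₁) ∧ a₁ ≠ v := by
      rcases hv X₁ hX₁ with h | h
      · exact ⟨P' X₁, Or.inr rfl, fun h' => hPP' X₁ (h.trans h'.symm)⟩
      · exact ⟨P X₁, Or.inl rfl, fun h' => hPP' X₁ (h'.trans h.symm)⟩
    obtain ⟨a₂, ha₂X, ha₂v⟩ : ∃ a₂, (P X₂ = a₂ ∨ P' X₂ = a₂) ∧ a₂ ≠ v := by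
      rcases hv X₂ hX₂ with h | h
      · exact ⟨P' X₂, Or.inr rfl, fun h' => hPP' X₂ (h.trans h'.symm)⟩
      · exact ⟨P X₂, Or.inl rfl, fun h' => hPP' X₂ (h'.trans h.symm)⟩
    have hs₁ : (s(P X₁, P' X₁) : Sym2 V) = s(v, a₁) := sym2_eq_of_mem_of_mem ha₁v.symm (hv X₁ hX₁) ha₁X
    have hs₂ : (s(P X₂, P' X₂) : Sym2 V) = s(v, a₂) := sym2_eq_of_mem_of_mem ha₂v.symm (hv X₂ hX₂) ha₂X
    have ha₁₂ : a₁ ≠ a₂ := by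
      intro h
      apply hne
      apply hinj
      simp only
      rw [hs₂, hs₁, h]
    -- ports of `X_i` are exactly `v, a_i`
    have hports : ∀ (X : ι) (a u : V), (s(P X, P' X) : Sym2 V) = s(v, a) → (P X = u ∨ P' X = u) → u = v ∨ u = a := by
      intro X a u hs hu
      have : u ∈ (s(P X, P' X) : Sym2 V) := by
        rw [Sym2.mem_iff]; exact hu.imp Eq.symm Eq.symm
      rw [hs, Sym2.mem_iff] at this
      exact this
    by_contra hYv
    have hYv' : ¬ (P Y = v ∨ P' Y = v) := hYv
    -- `Y` avoids `v`, is adjacent to `X₁` and `X₂`, so contains `a₁` and `a₂`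
    have hYa₁ : P Y = a₁ ∨ P' Y = a₁ := by
      rcases hadj X₁ hX₁ Y hY with h | h | h | h
      · rcases hports X₁ a₁ (P Y) hs₁ (Or.inl h) with h' | h'
        · exact absurd (Or.inl h') hYv'
        · exact Or.inl h'
      · rcases hports X₁ a₁ (P' Y) hs₁ (Or.inl h) with h' | h'
        · exact absurd (Or.inr h') hYv'
        · exact Or.inr h'
      · rcases hports X₁ a₁ (P Y) hs₁ (Or.inr h) with h' | h'
        · exact absurd (Or.inl h') hYv'
        · exact Or.inl h'
      · rcases hports X₁ a₁ (P' Y) hs₁ (Or.inr h) with h' | h'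
        · exact absurd (Or.inr h') hYv'
        · exact Or.inr h'
    have hYa₂ : P Y = a₂ ∨ P' Y = a₂ := by
      rcases hadj X₂ hX₂ Y hY with h | h | h | h
      · rcases hports X₂ a₂ (P Y) hs₂ (Or.inl h) with h' | h'
        · exact absurd (Or.inl h') hYv'
        · exact Or.inl h'
      · rcases hports X₂ a₂ (P' Y) hs₂ (Or.inl h) with h' | h'
        · exact absurd (Or.inr h') hYv'
        · exact Or.inr h'
      · rcases hports X₂ a₂ (P Y) hs₂ (Or.inr h) with h' | h'
        · exact absurd (Or.inl h') hYv'
        · exact Or.inl h'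
      · rcases hports X₂ a₂ (P' Y) hs₂ (Or.inr h) with h' | h'
        · exact absurd (Or.inr h') hYv'
        · exact Or.inr h'
    have hsY : (s(P Y, P' Y) : Sym2 V) = s(a₁, a₂) := sym2_eq_of_mem_of_mem ha₁₂ hYa₁ hYa₂
    -- `{X₁, X₂, Y}` is an r-free triangle on `v, a₁, a₂`
    exact hnotri ⟨v, a₁, a₂, ha₁v.symm, ha₂v.symm, ha₁₂, hvr, hport_ne_r X₁ hX₁ a₁ ha₁X, hport_ne_r X₂ hX₂ a₂ ha₂X,
      ⟨X₁, hΩω hX₁, hs₁⟩, ⟨X₂, hΩω hX₂, hs₂⟩, ⟨Y, hY, hsY⟩⟩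
  · -- no common port: the dichotomy gives a triangle inside `Ω`, which would be an r-free triangle inside `ω`
    exfalso
    rcases adjacent_family_star_or_triangle P P' hPP' Ω hΩne hΩadj with hst | ⟨a, b, c, hab, hac, hbc, htri⟩
    · exact hstar hst
    · obtain ⟨⟨X, hX, hsX⟩, ⟨Y, hY, hsY⟩, ⟨Z, hZ, hsZ⟩⟩ :=
        exists_three_of_triangle_of_not_star P P' Ω htri hstar
      exact hnotri ⟨a, b, c, hab, hac, hbc, hport_ne_r X hX a (hmem X a b hsX).1, hport_ne_r X hX b (hmem X a b hsX).2,
        hport_ne_r Y hY c (hmem Y a c hsY).2, ⟨X, hΩω hX, hsX⟩, ⟨Y, hΩω hY, hsY⟩, ⟨Z, hΩω hZ, hsZ⟩⟩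

/-- **A class adjacent to all three sides of a triangle is a side** (used for rule A0 of U1-PROOF.md: the Ω-chords of a configuration containing
a triangle are sides of it). -/
theorem portPair_of_adjacent_triangle (P P' : ι → V) (hPP' : ∀ X, P X ≠ P' X) {a b c : V} (hab : a ≠ b) (hac : a ≠ c) (hbc : b ≠ c)
    (X : ι) (hXab : P X = a ∨ P X = b ∨ P' X = a ∨ P' X = b) (hXac : P X = a ∨ P X = c ∨ P' X = a ∨ P' X = c)
    (hXbc : P X = b ∨ P X = c ∨ P' X = b ∨ P' X = c) :
    (s(P X, P' X) : Sym2 V) = s(a, b) ∨ (s(P X, P' X) : Sym2 V) = s(a, c) ∨ (s(P X, P' X) : Sym2 V) = s(b, c) := by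
  have hX := hPP' X
  -- both ports of `X` lie in `{a, b, c}`
  have hp : P X = a ∨ P X = b ∨ P X = c := by
    rcases hXab with h | h | h | h
    · exact Or.inl h
    · exact Or.inr (Or.inl h)
    · -- `P' X = a`; then `P X ∈ {b, c}` from `hXbc` unless `P' X ∈ {b,c}` (impossible, `P' X = a`)
      rcases hXbc with h' | h' | h' | h'
      · exact Or.inr (Or.inl h')
      · exact Or.inr (Or.inr h')
      · exact absurd (h.symm.trans h') hab
      · exact absurd (h.symm.trans h') hac
    · rcases hXac with h' | h' | h' | h'
      · exact Or.inl h'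
      · exact Or.inr (Or.inr h')
      · exact absurd (h.symm.trans h') (Ne.symm hab)
      · exact absurd (h.symm.trans h') hbc
  have hp' : P' X = a ∨ P' X = b ∨ P' X = c := by
    rcases hXab with h | h | h | h
    · rcases hXbc with h' | h' | h' | h'
      · exact absurd (h.symm.trans h') hab
      · exact absurd (h.symm.trans h') hac
      · exact Or.inr (Or.inl h')
      · exact Or.inr (Or.inr h')
    · rcases hXac with h' | h' | h' | h'
      · exact absurd (h.symm.trans h') (Ne.symm hab)
      · exact absurd (h.symm.trans h') hbc
      · exact Or.inl h'
      · exact Or.inr (Or.inr h')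
    · exact Or.inl h
    · exact Or.inr (Or.inl h)
  rcases hp with h1 | h1 | h1 <;> rcases hp' with h2 | h2 | h2
  · exact absurd (h1.trans h2.symm) hX
  · exact Or.inl (sym2_eq_of_mem_of_mem hab (Or.inl h1) (Or.inr h2))
  · exact Or.inr (Or.inl (sym2_eq_of_mem_of_mem hac (Or.inl h1) (Or.inr h2)))
  · exact Or.inl (sym2_eq_of_mem_of_mem hab (Or.inr h2) (Or.inl h1))
  · exact absurd (h1.trans h2.symm) hX
  · exact Or.inr (Or.inr (sym2_eq_of_mem_of_mem hbc (Or.inl h1) (Or.inr h2)))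
  · exact Or.inr (Or.inl (sym2_eq_of_mem_of_mem hac (Or.inr h2) (Or.inl h1)))
  · exact Or.inr (Or.inr (sym2_eq_of_mem_of_mem hbc (Or.inr h2) (Or.inl h1)))
  · exact absurd (h1.trans h2.symm) hX

/-- **At most three classes are adjacent to all three sides of a triangle** (port pairs pairwise distinct): the number of Ω-chords of a
configuration containing an r-free triangle is `≤ 3` (rule A0 of U1-PROOF.md). -/
theorem card_adjacent_triangle_le_three [DecidableEq V] (P P' : ι → V) (hPP' : ∀ X, P X ≠ P' X)
    (hinj : Function.Injective fun X => (s(P X, P' X) : Sym2 V)) {a b c : V} (hab : a ≠ b) (hac : a ≠ c) (hbc : b ≠ c)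
    (S : Finset ι) (hS : ∀ X ∈ S, (P X = a ∨ P X = b ∨ P' X = a ∨ P' X = b) ∧ (P X = a ∨ P X = c ∨ P' X = a ∨ P' X = c) ∧
      (P X = b ∨ P X = c ∨ P' X = b ∨ P' X = c)) : S.card ≤ 3 := by
  classical
  calc S.card = (S.image fun X => (s(P X, P' X) : Sym2 V)).card := (card_image_of_injective S hinj).symm
    _ ≤ ({s(a, b), s(a, c), s(b, c)} : Finset (Sym2 V)).card := by
        refine card_le_card fun e he => ?_
        obtain ⟨X, hX, rfl⟩ := mem_image.1 he
        obtain ⟨h1, h2, h3⟩ := hS X hX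
        rcases portPair_of_adjacent_triangle P P' hPP' hab hac hbc X h1 h2 h3 with h | h | h <;> simp [h]
    _ ≤ 3 := card_le_three

end StarSet

end Summit.CriticalPhenomena.PercolationContinuityZ3.Theorems
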